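import Literature.Computability.Cryptography.GraphPathProblems
import HarnessLib

/-!
# Weighted graph path problems — weight bounds for distance products and shortest distances

Quantitative companions to `Literature.Computability.Cryptography.GraphPathProblems` (the objects of
the APSP world of Vassilevska Williams–Williams, J. ACM 65 (2018)): if all finite weights lie in
`[-M, M]`, then

* every entry of the `(min,+)`-product of two such matrices (bounds `M`, `N`) is `⊤` or lies in
  `[-(M + N), M + N]` (`hasBoundedWeights_minPlusProduct`);
* every optimum over walks with at most `k` edges is `⊤` or lies in `[-k M, k M]`
  (`hasBoundedWeights_walkDistLE`), hence every entry of `shortestDist W` is `⊤` or lies in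
  `[-n M, n M]` with `n = Fintype.card ι` (`hasBoundedWeights_shortestDist`).

These are the (folklore) estimates behind two standing conventions of fine-grained APSP: "path
lengths fit in `O(1)` machine words when weights are polynomial" (Floyd–Warshall on the word RAM,
`APSP_inTimeO_cube`) and "the reductions blow the weight range up only polynomially" (VW–W 2018, §4,
p. 27:13: "if the original maximum weight absolute value was `W`, then the maximum weight absolute
value after the reduction is `poly(nW)`"), and they give the word-representability of the outputs of
the zoo problems `APSP c`, `MinPlusProduct c` (`FGProblem.HasWordOutputs`, used in
`Literature.Computability.FineGrained.SubcubicEquivalencesAPSP`).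

Everything here is proved (no named facts). The pointwise form of `HasBoundedWeights` is named
`IsBddWeight M a` (`a = ⊤ ∨ a ∈ [-M, M]`) to state the closure properties under `+`, `min` and
`Finset.inf` once.

## References

* V. Vassilevska Williams, R. R. Williams, *Subcubic equivalences between path, matrix, and triangle
  problems*, J. ACM 65 (2018), Art. 27, §4 p. 27:13. doi:10.1145/3186893
* T. H. Cormen, C. E. Leiserson, R. L. Rivest, C. Stein, *Introduction to Algorithms*, 3rd ed.,
  §25.1 (shortest paths and matrix multiplication: `L⁽ᵐ⁾` via the `(min,+)` recurrence).
-/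

namespace Literature.Computability.Cryptography

open Matrix Tropical

variable {ι : Type*}

/-! ### Bounded weights, pointwise -/

/-- `IsBddWeight M a`: the weight `a ∈ ℤ ∪ {∞}` is `⊤` (no edge / no walk) or a finite integer of
absolute value at most `M`; the pointwise form of `HasBoundedWeights` (`hasBoundedWeights_iff`).
[folklore] -/
def IsBddWeight (M : ℕ) (a : WithTop ℤ) : Prop :=
  a = ⊤ ∨ ∃ z : ℤ, a = z ∧ |z| ≤ M

/-- `HasBoundedWeights W M` says exactly that every entry of `W` is an `M`-bounded weight. [folklore] -/
theorem hasBoundedWeights_iff (W : Matrix ι ι (WithTop ℤ)) (M : ℕ) :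
    HasBoundedWeights W M ↔ ∀ i j, IsBddWeight M (W i j) :=
  Iff.rfl

namespace IsBddWeight

/-- `⊤` is a bounded weight. [folklore] -/
theorem top (M : ℕ) : IsBddWeight M ⊤ :=
  Or.inl rfl

/-- `0` is a bounded weight. [folklore] -/
theorem zero (M : ℕ) : IsBddWeight M 0 :=
  Or.inr ⟨0, rfl, by simp⟩

/-- A finite weight `z` with `|z| ≤ M` is an `M`-bounded weight. [folklore] -/
theorem coe {M : ℕ} {z : ℤ} (hz : |z| ≤ M) : IsBddWeight M z :=
  Or.inr ⟨z, rfl, hz⟩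

/-- Monotonicity in the bound. [folklore] -/
theorem mono {M N : ℕ} {a : WithTop ℤ} (h : IsBddWeight M a) (hMN : M ≤ N) : IsBddWeight N a := by
  rcases h with h | ⟨z, rfl, hz⟩
  · exact Or.inl h
  · exact Or.inr ⟨z, rfl, hz.trans (by exact_mod_cast hMN)⟩

/-- Bounded weights are closed under addition, with bounds adding up (`⊤` is absorbing). [folklore] -/
theorem add {M N : ℕ} {a b : WithTop ℤ} (ha : IsBddWeight M a) (hb : IsBddWeight N b) :
    IsBddWeight (M + N) (a + b) := by
  rcases ha with rfl | ⟨z, rfl, hz⟩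
  · exact Or.inl (WithTop.top_add _)
  rcases hb with rfl | ⟨z', rfl, hz'⟩
  · exact Or.inl (WithTop.add_top _)
  refine Or.inr ⟨z + z', (WithTop.coe_add z z').symm, ?_⟩
  calc |z + z'| ≤ |z| + |z'| := abs_add_le z z'
    _ ≤ (M : ℤ) + N := add_le_add hz hz'
    _ = ((M + N : ℕ) : ℤ) := by push_cast; ring

/-- Bounded weights are closed under `min`. [folklore] -/
theorem min {M : ℕ} {a b : WithTop ℤ} (ha : IsBddWeight M a) (hb : IsBddWeight M b) :
    IsBddWeight M (min a b) := by
  rcases le_total a b with h | h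
  · rwa [min_eq_left h]
  · rwa [min_eq_right h]

/-- Bounded weights are closed under finite infima (the empty infimum is `⊤`). [folklore] -/
theorem finset_inf {κ : Type*} {M : ℕ} (s : Finset κ) {f : κ → WithTop ℤ}
    (h : ∀ k ∈ s, IsBddWeight M (f k)) : IsBddWeight M (s.inf f) := by
  classical
  induction s using Finset.induction_on with
  | empty => exact Or.inl Finset.inf_empty
  | insert a s ha ih =>
    rw [Finset.inf_insert]
    exact (h a (Finset.mem_insert_self a s)).min
      (ih fun k hk => h k (Finset.mem_insert_of_mem hk))

end IsBddWeight

/-- The one-step matrix `1 + tropAdj W` of the `(min,+)` recurrence has entries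
`min (if l = j then 0 else ⊤) (W l j)`: stay put at cost `0`, or take the edge `l → j`.
CLRS §25.1. [folklore] -/
theorem untrop_one_add_tropAdj_apply [DecidableEq ι] (W : Matrix ι ι (WithTop ℤ)) (l j : ι) :
    untrop ((1 + tropAdj W) l j) = min (if l = j then 0 else ⊤) (W l j) := by
  rw [Matrix.add_apply, untrop_add, tropAdj_apply, untrop_trop, Matrix.one_apply]
  split_ifs <;> simp

section Fintype

variable [Fintype ι]

/-- **The distance product enlarges the weight range additively.** If `A` has weights in `[-M, M]`
and `B` in `[-N, N]`, then every finite entry `minₖ (A i k + B k j)` of `minPlusProduct A B` lies in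
`[-(M + N), M + N]` (VW–W 2018, §4, p. 27:13: the reductions produce weights `poly(nW)`).
[cite: VassilevskaWilliamsWilliams2018, §4 p. 27:13] -/
theorem hasBoundedWeights_minPlusProduct {A B : Matrix ι ι (WithTop ℤ)} {M N : ℕ}
    (hA : HasBoundedWeights A M) (hB : HasBoundedWeights B N) :
    HasBoundedWeights (minPlusProduct A B) (M + N) := by
  intro i j
  show IsBddWeight (M + N) (minPlusProduct A B i j)
  rw [minPlusProduct_apply]
  exact IsBddWeight.finset_inf _ fun k _ => IsBddWeight.add (hA i k) (hB k j)

variable [DecidableEq ι]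

/-- Entries of `walkDistLE W k` are entries of the `k`-th tropical power of `1 + tropAdj W`
(definition unfolding). [folklore] -/
theorem walkDistLE_apply (W : Matrix ι ι (WithTop ℤ)) (k : ℕ) (i j : ι) :
    walkDistLE W k i j = untrop (((1 + tropAdj W) ^ k) i j) :=
  rfl

/-- **Walk optima stay in a linearly growing weight range.** If all weights lie in `[-M, M]`, the
minimum weight of a walk with at most `k` edges between any two vertices is `⊤` or lies in
`[-k M, k M]` (induction on `k` along the CLRS §25.1 recurrence
`L⁽ᵏ⁺¹⁾ i j = minₗ (L⁽ᵏ⁾ i l + (1 + W) l j)`). [folklore] -/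
theorem hasBoundedWeights_walkDistLE {W : Matrix ι ι (WithTop ℤ)} {M : ℕ}
    (hW : HasBoundedWeights W M) : ∀ k : ℕ, HasBoundedWeights (walkDistLE W k) (k * M)
  | 0 => fun i j => by
      rw [walkDistLE_zero, Matrix.of_apply, Nat.zero_mul]
      split_ifs
      · exact IsBddWeight.zero 0
      · exact IsBddWeight.top 0
  | k + 1 => fun i j => by
      show IsBddWeight ((k + 1) * M) (walkDistLE W (k + 1) i j)
      rw [walkDistLE_apply, pow_succ, Matrix.mul_apply, Finset.untrop_sum', Nat.succ_mul]
      refine IsBddWeight.finset_inf _ fun l _ => ?_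
      show IsBddWeight (k * M + M) (untrop (((1 + tropAdj W) ^ k) i l * (1 + tropAdj W) l j))
      rw [untrop_mul, untrop_one_add_tropAdj_apply]
      refine IsBddWeight.add (hasBoundedWeights_walkDistLE hW k i l) (IsBddWeight.min ?_ (hW l j))
      split_ifs
      · exact IsBddWeight.zero M
      · exact IsBddWeight.top M

/-- **Shortest distances with weights in `[-M, M]` lie in `[-n M, n M]`** (`n = Fintype.card ι`),
whenever finite: `shortestDist W` optimises over walks with at most `n` edges. This is why APSP
with polynomially bounded weights has word-representable outputs on the word RAM, and why the
weight range grows only polynomially along the reductions of VW–W 2018 (§4, p. 27:13).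
[cite: VassilevskaWilliamsWilliams2018, §4 p. 27:13] -/
theorem hasBoundedWeights_shortestDist {W : Matrix ι ι (WithTop ℤ)} {M : ℕ}
    (hW : HasBoundedWeights W M) : HasBoundedWeights (shortestDist W) (Fintype.card ι * M) :=
  hasBoundedWeights_walkDistLE hW _

end Fintype

end Literature.Computability.Cryptography
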